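import Literature.NumberTheory.DiophantineGeometry.RothIndexTheorem

/-!
# The `p`-adic Roth theorem over `ℚ` (Ridout) — I. The Index Theorem for several targets

Towards a proof of the `p`-adic Thue–Siegel–Roth theorem for integers over `ℚ` (D. Ridout 1958
[Ridout1958]; K. Mahler 1961; Bombieri–Gubler [BombieriGubler2006] Thm. 6.2.3 with 6.2.5–6.2.6)
— the hypothesis `hR` of `BugeaudEvertseGyory2018_SPartPolynomialValues_of_padicRoth`
(`SPartPolynomialValuesProofs.lean`) — on top of the tree's sorry-free proof of Roth's theorem
after W. M. Schmidt, *Diophantine Approximation*, LNM 785, Ch. V [Schmidt1980]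
(`Literature/NumberTheory/DiophantineGeometry/Roth*`: the operators `Roth.hasseD`, heights, the
index `Roth.IndexGe`, the Index Theorem 7A `Roth.indexTheorem`, Roth's Lemma 10A
`Roth.rothLemma`).

The one new ingredient in the auxiliary construction of the several-places proof (B–G §6.4 via
Lemma 6.3.4 with `n = |S|` points; Mahler/Ridout) is that the auxiliary polynomial must vanish to
high index at the diagonal point `(θ_v, …, θ_v)` for EVERY place `v ∈ S` simultaneously, the
`θ_v` being unrelated algebraic integers (roots of monic `Q_v ∈ ℤ[X]`) living in different
completions. This file proves exactly that generalisation of Schmidt's Theorem 7A, by Schmidt's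
own argument (Lemma 4A `Roth.card_filter_wt_le`, Lemma 5C `Roth.powerCoeffs_spec`, Siegel's
Lemma 5B `Roth.siegel`): the `Σ_v deg Q_v =: D` integer linear conditions per multi-index replace
Schmidt's `d`, and `m > 16 ε⁻² log(4D)` replaces `m > 16 ε⁻² log(4d)`.

Main result: `Ridout.indexTheorem` — for monic `Q_i ∈ ℤ[X]` of degrees `d_i ≥ 1` (`i` in a finite
index type), `D = Σ d_i`, there is `B ≥ 1` (namely `4(Σ_i |Q_i| + 1)`) such that for `ε > 0`,
`m > 16ε⁻² log(4D)` and positive `r₀,…,r_{m-1}` there is `P ∈ ℤ[X₀,…,X_{m-1}]`, `P ≠ 0`,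
`deg_{X_h} P ≤ r_h`, `|P| ≤ B^{Σ r_h}`, with index `≥ (m/2)(1-ε)` at `(θ, …, θ)` for EVERY root `θ`
of ANY `Q_i` in ANY commutative ring (the vanishing of `P_I(θ,…,θ)` is forced through
`Q_i`-divisibility relations with integer coefficients, so it holds for all roots of `Q_i` at
once: in `ℝ`, in `\overline{ℚ_p}`, …). The target `θ = 0` (the place `∞` with `α_∞ = ∞` after
a Möbius transformation, B–G 6.2.5) is the case `Q = X`.

## References

* [Schmidt1980] W. M. Schmidt, *Diophantine Approximation*, LNM 785, Springer 1980, Ch. V §7,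
  Theorem 7A (pp. 124–125), Lemmas 4A, 5B, 5C.
* [BombieriGubler2006] E. Bombieri, W. Gubler, *Heights in Diophantine Geometry*, CUP 2006,
  Lemma 6.3.4 (several points), §6.4 (proof of Thm. 6.4.1), 6.2.5–6.2.6.
* [Ridout1958] D. Ridout, *The `p`-adic generalization of the Thue–Siegel–Roth theorem*,
  Mathematika 5 (1958) 40–48.
-/

noncomputable section

open MvPolynomial Finset Real
open scoped Polynomial

namespace Literature.NumberTheory.DiophantineApproximation

namespace Ridout

open Literature.NumberTheory.DiophantineGeometry.Roth

/-- The value of `(c X^f)_I` at a diagonal point `(θ, …, θ)` of any commutative ring: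
`(c X^f)_I (θ, …, θ) = Π_h C(f_h, I_h) · c · θ^{Σ_h (f_h - I_h)}` (Schmidt's (7.2); the tree's
`Roth.aeval_const_hasseD_monomial` is the case of `ℝ`). [cite: Schmidt1980, Ch. V §7 (7.2)] -/
theorem aeval_const_hasseD_monomial {A : Type*} [CommRing A] {m : ℕ} (θ : A) (i : Fin m →₀ ℕ)
    (f : Fin m → ℕ) (c : ℤ) :
    aeval (fun _ : Fin m => θ) (hasseD i (monomial (Finsupp.equivFunOnFinite.symm f) c)) =
      ((∏ h, (f h).choose (i h) : ℕ) : A) * (c : A) * θ ^ (∑ h, (f h - i h)) := by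
  rw [hasseD_monomial, MvPolynomial.aeval_monomial, Finsupp.prod_fintype _ _ (fun _ => pow_zero θ),
    prod_pow_eq_pow_sum, Finsupp.prod_fintype _ _ (fun h => by simp)]
  simp only [Finsupp.coe_tsub, Pi.sub_apply, Finsupp.coe_equivFunOnFinite_symm, map_mul,
    map_natCast, eq_intCast]

/-- **The Index Theorem for several targets** (Schmidt's Theorem 7A, Ch. V §7, with `d` replaced
by `D = Σ_i deg Q_i`; the auxiliary construction of Bombieri–Gubler Lemma 6.3.4 / §6.4 for several
points, over `ℚ`): let `Q_i ∈ ℤ[X]` (`i ∈ ι`, finite) be monic of degrees `d_i ≥ 1`, `D = Σ_i d_i`.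
There is `B ≥ 1` (namely `4(Σ_i |Q_i| + 1)`) such that for every `ε > 0`, every integer
`m > 16ε⁻² log(4D)` and all positive integers `r₀, …, r_{m-1}` there is a polynomial
`P(X₀,…,X_{m-1}) ≠ 0` with integer coefficients, of degree `≤ r_h` in `X_h`, of height
`|P| ≤ B^{r₀+⋯+r_{m-1}}`, whose index at `(θ,…,θ)` with respect to `(r₀,…,r_{m-1})` is
`≥ (m/2)(1-ε)` for every `i`, every commutative ring `A` and every root `θ ∈ A` of `Q_i`.
Proof as printed for 7A: `N = Π(r_h+1)` unknowns; by Lemma 4A at most `N e^{-ε²m/16} < N/(4D)`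
multi-indices `I` with `Σ I_h/r_h < (m/2)(1-ε)`; for each such `I` and each `i` the condition
`P_I(θ,…,θ) = 0` follows from `d_i` integer linear equations (expand
`θ^ℓ = Σ_{k<d_i} a^{(ℓ)}_{i,k} θ^k`, Lemma 5C, valid for every root of the monic `Q_i` in every
ring) with coefficients `≤ (2(Σ|Q_i|+1))^{Σ r_h}`; Siegel's lemma.
[cite: Schmidt1980, Ch. V Theorem 7A (proof); BombieriGubler2006, Lemma 6.3.4] -/
theorem indexTheorem {ι : Type} [Fintype ι] (Q : ι → ℤ[X]) (hQm : ∀ i, (Q i).Monic)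
    (hQd : ∀ i, 1 ≤ (Q i).natDegree) :
    ∃ B : ℕ, 1 ≤ B ∧
      ∀ (ε : ℝ), 0 < ε → ∀ (m : ℕ), 16 / ε ^ 2 * Real.log (4 * ∑ i, (Q i).natDegree) < m →
        ∀ (r : ℕ → ℕ), (∀ h, h < m → 0 < r h) →
          ∃ P : MvPolynomial (Fin m) ℤ, P ≠ 0 ∧ (∀ h : Fin m, P.degreeOf h ≤ r h) ∧
            (∀ i, ∀ (A : Type) [CommRing A] (θ : A), Polynomial.aeval θ (Q i) = 0 →
              IndexGe P (fun _ : Fin m => θ) (fun h : Fin m => r h) (m / 2 * (1 - ε))) ∧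
            height P ≤ B ^ (∑ h : Fin m, r h) := by
  classical
  set D : ℕ := ∑ i, (Q i).natDegree with hD
  set H : ℕ := ∑ i, polyHeight (Q i) with hH
  have hHi : ∀ i, polyHeight (Q i) ≤ H := fun i =>
    Finset.single_le_sum (f := fun i => polyHeight (Q i)) (fun _ _ => Nat.zero_le _) (mem_univ i)
  refine ⟨4 * (H + 1), by omega, ?_⟩
  intro ε hε m hm r hr
  -- the trivial case `ε ≥ 1`: the index condition is vacuous and `P = 1` works
  by_cases hε1 : 1 ≤ ε
  · refine ⟨1, one_ne_zero, fun h => by simp, ?_, ?_⟩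
    · intro i A _ θ _
      apply indexGe_of_nonpos
      have : (0 : ℝ) ≤ m / 2 := by positivity
      nlinarith
    · have : height (1 : MvPolynomial (Fin m) ℤ) ≤ 1 := by
        rw [height_le_iff]
        intro j
        rw [MvPolynomial.coeff_one]
        split_ifs <;> simp
      exact this.trans (Nat.one_le_pow _ _ (by omega))
  push Not at hε1
  -- notation
  set rr : Fin m → ℕ := fun h => r h with hrr
  have hrr0 : ∀ h, 0 < rr h := fun h => hr h h.isLt
  set S : ℕ := ∑ h, rr h with hS
  set box : Finset (Fin m → ℕ) := Fintype.piFinset fun h => range (rr h + 1) with hbox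
  set N : ℕ := ∏ h, (rr h + 1) with hN
  have hboxcard : box.card = N := by
    rw [hbox, Fintype.card_piFinset]; simp [hN]
  have hNR : (N : ℝ) = ∏ h, ((rr h : ℝ) + 1) := by rw [hN]; push_cast; rfl
  have hNpos : 0 < N := prod_pos fun h _ => Nat.succ_pos _
  -- the conditions (7.2)
  set I : Finset (Fin m → ℕ) :=
    box.filter fun i => (∑ h, (i h : ℝ) / rr h) < m / 2 * (1 - ε) with hI
  -- the degenerate case `D = 0` (no targets): `P = 1`
  by_cases hD0 : D = 0
  · refine ⟨1, one_ne_zero, fun h => by simp, ?_, ?_⟩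
    · intro i
      exfalso
      have : (Q i).natDegree ≤ D :=
        Finset.single_le_sum (f := fun i => (Q i).natDegree) (fun _ _ => Nat.zero_le _) (mem_univ i)
      have := hQd i
      omega
    · have : height (1 : MvPolynomial (Fin m) ℤ) ≤ 1 := by
        rw [height_le_iff]
        intro j
        rw [MvPolynomial.coeff_one]
        split_ifs <;> simp
      exact this.trans (Nat.one_le_pow _ _ (by omega))
  have hDpos : 0 < D := Nat.pos_of_ne_zero hD0
  have hDR : (1 : ℝ) ≤ D := by exact_mod_cast hDpos
  -- Lemma 4A: `#I ≤ N e^{-ε² m / 16} < N / (4D)`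
  have hIcard : (I.card : ℝ) ≤ N * exp (-((ε / 2) ^ 2 * m / 4)) := by
    have hsub : I ⊆ box.filter fun i : Fin m → ℕ =>
        (∑ h, (i h : ℝ) / rr h) - m / 2 ≤ -(ε / 2 * m) := by
      intro i hi
      rw [hI, mem_filter] at hi
      rw [mem_filter]
      exact ⟨hi.1, by linarith [hi.2]⟩
    calc (I.card : ℝ) ≤ ((box.filter fun i : Fin m → ℕ =>
          (∑ h, (i h : ℝ) / rr h) - m / 2 ≤ -(ε / 2 * m)).card : ℝ) := by
          exact_mod_cast card_le_card hsub
      _ ≤ (∏ h, ((rr h : ℝ) + 1)) * exp (-((ε / 2) ^ 2 * m / 4)) :=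
          card_filter_wt_le m rr hrr0 (ε / 2) (by positivity) (by linarith)
      _ = N * exp (-((ε / 2) ^ 2 * m / 4)) := by rw [hNR]
  have hexp : exp (-((ε / 2) ^ 2 * m / 4)) < 1 / (4 * D) := by
    have h1 : Real.log (4 * D) < ε ^ 2 * m / 16 := by
      have h2 : 16 / ε ^ 2 * Real.log (4 * D) * (ε ^ 2 / 16) < m * (ε ^ 2 / 16) :=
        mul_lt_mul_of_pos_right hm (by positivity)
      have h3 : 16 / ε ^ 2 * Real.log (4 * D) * (ε ^ 2 / 16) = Real.log (4 * D) := by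
        field_simp
      linarith
    rw [Real.log_lt_iff_lt_exp (by positivity)] at h1
    rw [show (ε / 2) ^ 2 * m / 4 = ε ^ 2 * m / 16 by ring, exp_neg, one_div]
    exact (inv_lt_inv₀ (exp_pos _) (by positivity)).mpr h1
  have hId : 4 * D * I.card < N := by
    have h1 : (I.card : ℝ) < N * (1 / (4 * D)) := by
      refine hIcard.trans_lt ?_
      exact mul_lt_mul_of_pos_left hexp (by exact_mod_cast hNpos)
    have h2 : (I.card : ℝ) * (4 * D) < N := by
      rw [mul_one_div] at h1
      exact (lt_div_iff₀ (by positivity)).mp h1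
    have h3 : ((4 * D * I.card : ℕ) : ℝ) < N := by push_cast; linarith
    exact_mod_cast h3
  -- the case of no conditions: `P = 1`
  by_cases hI0 : I.card = 0
  · have hIe : I = ∅ := card_eq_zero.mp hI0
    refine ⟨1, one_ne_zero, fun h => by simp, ?_, ?_⟩
    · intro i A _ θ _ j hj
      by_cases hjb : (⇑j : Fin m → ℕ) ∈ box
      · have : (⇑j : Fin m → ℕ) ∈ I := by
          rw [hI, mem_filter]; exact ⟨hjb, by simpa [wt] using hj⟩
        rw [hIe] at this
        exact absurd this (notMem_empty _)
      · rw [hbox, Fintype.mem_piFinset] at hjb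
        push Not at hjb
        obtain ⟨h, hh⟩ := hjb
        rw [mem_range, not_lt] at hh
        have : degreeOf h (1 : MvPolynomial (Fin m) ℤ) < j h := by simp; omega
        rw [hasseD_eq_zero_of_degreeOf_lt this, map_zero]
    · have : height (1 : MvPolynomial (Fin m) ℤ) ≤ 1 := by
        rw [height_le_iff]
        intro j
        rw [MvPolynomial.coeff_one]
        split_ifs <;> simp
      exact this.trans (Nat.one_le_pow _ _ (by omega))
  -- the linear system: conditions indexed by `I × (Σ i, Fin d_i)`, unknowns by the box
  have hIpos : 0 < I.card := Nat.pos_of_ne_zero hI0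
  set bc : (Fin m → ℕ) → (Fin m → ℕ) → ℕ := fun i f => ∏ h, (f h).choose (i h) with hbc
  set ld : (Fin m → ℕ) → (Fin m → ℕ) → ℕ := fun i f => ∑ h, (f h - i h) with hld
  set a : (↥I × (Σ i : ι, Fin (Q i).natDegree)) → ↥box → ℤ :=
    fun e u => (bc e.1.1 u.1 : ℤ) * powerCoeffs (Q e.2.1) (ld e.1.1 u.1) e.2.2 with ha
  set Amax : ℝ := (2 * ((H : ℝ) + 1)) ^ S with hAmax
  have hH1 : (1 : ℝ) ≤ (H : ℝ) + 1 := by linarith [(Nat.cast_nonneg H : (0 : ℝ) ≤ H)]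
  have hAmax1 : 1 ≤ Amax := one_le_pow₀ (by linarith)
  -- bounds for the entries
  have hbox_le : ∀ f ∈ box, ∀ h, f h ≤ rr h := by
    intro f hf h
    rw [hbox, Fintype.mem_piFinset] at hf
    exact Nat.lt_succ_iff.mp (mem_range.mp (hf h))
  have hsum_le : ∀ f ∈ box, ∑ h, f h ≤ S := fun f hf => sum_le_sum fun h _ => hbox_le f hf h
  have hbc_le : ∀ i, ∀ f ∈ box, bc i f ≤ 2 ^ S := by
    intro i f hf
    calc bc i f ≤ ∏ h, 2 ^ f h := prod_le_prod' fun h _ => Nat.choose_le_two_pow _ _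
      _ = 2 ^ ∑ h, f h := prod_pow_eq_pow_sum _ _ _
      _ ≤ 2 ^ S := Nat.pow_le_pow_right (by norm_num) (hsum_le f hf)
  have hld_le : ∀ i, ∀ f ∈ box, ld i f ≤ S := fun i f hf =>
    (sum_le_sum fun h _ => Nat.sub_le _ _).trans (hsum_le f hf)
  have ha_le : ∀ e u, |(a e u : ℝ)| ≤ Amax := by
    rintro ⟨⟨i, hi⟩, ⟨t, k⟩⟩ ⟨f, hf⟩
    rw [ha]
    dsimp only
    push_cast
    rw [abs_mul, hAmax, mul_pow]
    apply mul_le_mul _ _ (abs_nonneg _) (by positivity)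
    · rw [Nat.abs_cast]
      exact_mod_cast hbc_le i f hf
    · have := abs_powerCoeffs_le (Q t) (ld i f) k
      have h' : (|powerCoeffs (Q t) (ld i f) k| : ℝ) ≤ ((H : ℝ) + 1) ^ (ld i f) := by
        have h'' : (|powerCoeffs (Q t) (ld i f) k| : ℝ) ≤
            ((polyHeight (Q t) : ℝ) + 1) ^ (ld i f) := by exact_mod_cast this
        refine h''.trans (pow_le_pow_left₀ (by positivity) ?_ _)
        have := hHi t
        exact_mod_cast Nat.add_le_add_right this 1
      exact h'.trans (pow_le_pow_right₀ hH1 (hld_le i f hf))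
  -- Siegel's lemma
  have hcardE : Fintype.card (↥I × (Σ i : ι, Fin (Q i).natDegree)) = I.card * D := by
    rw [Fintype.card_prod, Fintype.card_coe, Fintype.card_sigma]
    simp [hD]
  have hcardU : Fintype.card ↥box = N := by rw [Fintype.card_coe, hboxcard]
  have hE : 0 < Fintype.card (↥I × (Σ i : ι, Fin (Q i).natDegree)) := by rw [hcardE]; positivity
  have hEU : Fintype.card (↥I × (Σ i : ι, Fin (Q i).natDegree)) < Fintype.card ↥box := by
    rw [hcardE, hcardU]; nlinarith
  obtain ⟨x, hx0, hxle, hax⟩ := siegel a hE hEU hAmax1 ha_le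
  rw [hcardE, hcardU] at hxle
  -- the bound `|x_u| ≤ B^S`
  have hB : ∀ u, (x u).natAbs ≤ (4 * (H + 1)) ^ S := by
    intro u
    have h1 := hxle u
    have hbase : (1 : ℝ) ≤ N * Amax := by
      have : (1 : ℝ) ≤ N := by exact_mod_cast hNpos
      nlinarith
    have hexp1 : ((I.card * D : ℕ) : ℝ) / (N - (I.card * D : ℕ)) ≤ 1 := by
      have h2 : ((I.card * D : ℕ) : ℝ) * 2 ≤ N := by
        have : I.card * D * 2 ≤ N := by nlinarith
        exact_mod_cast this
      have h3 : (0 : ℝ) < N - (I.card * D : ℕ) := by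
        have : ((I.card * D : ℕ) : ℝ) < N := by exact_mod_cast (hcardE ▸ hcardU ▸ hEU)
        linarith
      rw [div_le_one h3]
      linarith
    have h4 : (N * Amax : ℝ) ^ (((I.card * D : ℕ) : ℝ) / (N - (I.card * D : ℕ))) ≤ N * Amax := by
      calc (N * Amax : ℝ) ^ (((I.card * D : ℕ) : ℝ) / (N - (I.card * D : ℕ)))
          ≤ (N * Amax : ℝ) ^ (1 : ℝ) := Real.rpow_le_rpow_of_exponent_le hbase hexp1
        _ = N * Amax := Real.rpow_one _
    have hN2 : (N : ℝ) ≤ 2 ^ S := by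
      have : N ≤ 2 ^ S := by
        calc N = ∏ h, (rr h + 1) := hN
          _ ≤ ∏ h, 2 ^ rr h := prod_le_prod' fun h _ => Nat.succ_le_of_lt Nat.lt_two_pow_self
          _ = 2 ^ S := prod_pow_eq_pow_sum _ _ _
      exact_mod_cast this
    have h5 : (N : ℝ) * Amax ≤ ((4 * (H + 1)) ^ S : ℕ) := by
      push_cast
      rw [show (4 : ℝ) * (H + 1) = 2 * (2 * (H + 1)) by ring, mul_pow]
      exact mul_le_mul_of_nonneg_right hN2 (by positivity)
    have h6 : ((x u).natAbs : ℝ) ≤ ((4 * (H + 1)) ^ S : ℕ) := by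
      rw [Nat.cast_natAbs, Int.cast_abs]
      exact h1.trans (h4.trans h5)
    exact_mod_cast h6
  -- the polynomial
  set fs : (Fin m → ℕ) → (Fin m →₀ ℕ) := fun f => Finsupp.equivFunOnFinite.symm f with hfs
  have hfs_coe : ∀ f, ⇑(fs f) = f := fun f => Finsupp.coe_equivFunOnFinite_symm f
  have hfs_inj : Function.Injective fs := fun f g hfg => by
    rw [← hfs_coe f, ← hfs_coe g, hfg]
  set P : MvPolynomial (Fin m) ℤ := ∑ u : ↥box, monomial (fs u.1) (x u) with hP
  have hcoeffP : ∀ u : ↥box, coeff (fs u.1) P = x u := by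
    intro u
    rw [hP, MvPolynomial.coeff_sum, Finset.sum_eq_single u]
    · simp
    · intro v _ hvu
      rw [MvPolynomial.coeff_monomial, if_neg]
      intro h
      exact hvu (Subtype.ext (hfs_inj h))
    · intro h; exact absurd (mem_univ u) h
  have hcoeffP0 : ∀ n : Fin m →₀ ℕ, (⇑n : Fin m → ℕ) ∉ box → coeff n P = 0 := by
    intro n hn
    rw [hP, MvPolynomial.coeff_sum]
    refine sum_eq_zero fun v _ => ?_
    rw [MvPolynomial.coeff_monomial, if_neg]
    intro h
    apply hn
    rw [← h, hfs_coe]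
    exact v.2
  have hcoeffP' : ∀ n : Fin m →₀ ℕ, ∀ hn : (⇑n : Fin m → ℕ) ∈ box, coeff n P = x ⟨⇑n, hn⟩ := by
    intro n hn
    have := hcoeffP ⟨⇑n, hn⟩
    simpa [hfs] using this
  -- degrees
  have hdegP : ∀ h : Fin m, P.degreeOf h ≤ r h := by
    intro h
    rw [degreeOf_le_iff]
    intro n hn
    have hnb : (⇑n : Fin m → ℕ) ∈ box := by
      by_contra hnb
      exact (mem_support_iff.mp hn) (hcoeffP0 n hnb)
    exact hbox_le _ hnb h
  refine ⟨P, ?_, hdegP, ?_, ?_⟩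
  · -- `P ≠ 0`
    obtain ⟨u, hu⟩ := Function.ne_iff.mp hx0
    intro hP0
    apply hu
    rw [← hcoeffP u, hP0, MvPolynomial.coeff_zero]
    rfl
  · -- the index condition (ii), for every target `i`, every ring `A` and every root `θ` of `Q_i`
    intro t A _ θ hθ i hi
    have hd1 : 1 ≤ (Q t).natDegree := hQd t
    by_cases hib : (⇑i : Fin m → ℕ) ∈ box
    · have hiI : (⇑i : Fin m → ℕ) ∈ I := by
        rw [hI, mem_filter]; exact ⟨hib, by simpa [wt] using hi⟩
      have hx0' : ∀ k : Fin (Q t).natDegree,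
          ∑ u : ↥box, ((bc ⇑i u.1 : A) * (powerCoeffs (Q t) (ld ⇑i u.1) k : A)) * (x u : A) =
            0 := by
        intro k
        have := hax ⟨⟨⇑i, hiI⟩, ⟨t, k⟩⟩
        rw [ha] at this
        have hcast : ((∑ u : ↥box,
            (bc ⇑i u.1 : ℤ) * powerCoeffs (Q t) (ld ⇑i u.1) k * x u : ℤ) : A) = 0 := by
          rw [this]; simp
        push_cast at hcast
        exact hcast
      rw [hP, hasseD_sum, map_sum]
      have hterm : ∀ u : ↥box, aeval (fun _ : Fin m => θ) (hasseD i (monomial (fs u.1) (x u))) =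
          ∑ k ∈ range (Q t).natDegree,
            ((bc ⇑i u.1 : A) * (powerCoeffs (Q t) (ld ⇑i u.1) k : A) * (x u : A)) * θ ^ k := by
        intro u
        rw [hfs, aeval_const_hasseD_monomial, powerCoeffs_spec (Q t) (hQm t) hd1 θ hθ, mul_sum]
        refine sum_congr rfl fun k _ => ?_
        rw [hbc, hld]
        ring
      rw [sum_congr rfl fun u _ => hterm u, sum_comm]
      refine sum_eq_zero fun k hk => ?_
      rw [← sum_mul, hx0' ⟨k, mem_range.mp hk⟩, zero_mul]
    · rw [hbox, Fintype.mem_piFinset] at hib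
      push Not at hib
      obtain ⟨h, hh⟩ := hib
      rw [mem_range, not_lt] at hh
      have : degreeOf h P < i h := lt_of_le_of_lt (hdegP h) (by rw [hrr] at hh; exact hh)
      rw [hasseD_eq_zero_of_degreeOf_lt this, map_zero]
  · -- the height bound (iii)
    rw [height_le_iff]
    intro n
    by_cases hnb : (⇑n : Fin m → ℕ) ∈ box
    · rw [hcoeffP' n hnb]
      exact hB _
    · rw [hcoeffP0 n hnb]
      simp

end Ridout

end Literature.NumberTheory.DiophantineApproximation

end
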